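import Summits.Ventures.LatticeQCDFlow.Scaling.StarAdditiveCertificate

/-!
HONEST FRAMING: exact (Metropolis-corrected) sampling algorithms for lattice gauge theory; figures
of merit are autocorrelation/cost numbers at stated couplings and volumes; no continuum-physics
claim.

# StarAdditiveCertificateList — THE ENVIRONMENT-FREE ADDITIVE CERTIFICATE NEEDS NO LUMPING: ARBITRARY HUB LISTS (EVERY COLD LEVEL LISTED `≥ c` TIMES), RATE `σκ₀·c/m`
# (lean-2 GEN-34, ours)

Venture-side (OURS).  Cell `lqcd-flow` (pub-lqcd), unit `pub-lqcd-lean-2-g34`, 2026-08-29.  Chapter U, file 9.  `StarAdditiveCertificate` (U1) went through T5's type-lumped checklist and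
therefore asked for a UNIFORM entry list.  Nothing in the additive certificate uses exchangeability of the levels: here the same reduction is done at configuration level on S2's
checklist (`starCycle_mixingTime_le_of_idle_supersolution`), for ANY hub list `(0, κ_r+1)` in which every cold level appears at least `c` times, with the potential
`Ψ(x,y) = Σ_l G(x_l, y_l)` and the cycle value `F = Ψ − (σ/m)·Σ_r net(x_0; x_{κ_r+1}, y_{κ_r+1})` at agreeing hubs, `F = Ψ + σE(x_0,y_0)` at disagreeing hubs.  Under the three scalar
inequalities (N), (D), (R) of U1 the conclusion is `t_mix(ε) ≤ ⌈(4/((1−t)w_0·ρ))·log((e·K·G_max+1)/ε)⌉₊` with `ρ = σκ₀·c/m` — the `c/m` of chapter M (uniform list: `c/m = 1/K`, U1).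

Proved: §1 `levelSum_*`, `list_sum_eq_card_sum` (bookkeeping); §2 `addCertL_value_le`, **`addCertL_bracket_agree_le`**, **`addCertL_bracket_disagree_le`** (per-ENTRY brackets);
§3 **`homStar_mixingTime_le_of_additiveCertificate_list`**.  NOT CLAIMED: anything measured.  Literature grade (cell rule): OWN, elementary; nothing cited as a fact; no new bib keys.
-/

noncomputable section
open Finset Function
open Literature.Probability.MarkovChains

namespace Summit.Ventures.LatticeQCDFlow.Scaling

/-! ## §1 Bookkeeping over levels and over the list -/

section Book
variable {K m : ℕ} {S : Type*} (κ : Fin m → Fin K) {G : S → S → ℝ}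

/-- Two configuration pairs that agree off cold level `j+1` have level sums differing by the level-`j+1` terms. [ours] -/
theorem levelSum_congr_off (j : Fin K) {x y x' y' : Fin (K + 1) → S}
    (hx : ∀ i : Fin K, i ≠ j → x' i.succ = x i.succ) (hy : ∀ i : Fin K, i ≠ j → y' i.succ = y i.succ) :
    ∑ i : Fin K, G (x' i.succ) (y' i.succ) = ∑ i : Fin K, G (x i.succ) (y i.succ) - G (x j.succ) (y j.succ) + G (x' j.succ) (y' j.succ) := by
  have h : ∑ i : Fin K, (G (x' i.succ) (y' i.succ) - G (x i.succ) (y i.succ)) = G (x' j.succ) (y' j.succ) - G (x j.succ) (y j.succ) := by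
    rw [Finset.sum_eq_single j]
    · intro i _ hij; rw [hx i hij, hy i hij, sub_self]
    · intro hj; exact absurd (mem_univ j) hj
  rw [Finset.sum_sub_distrib] at h
  linarith

/-- Level sum after a joint identity-map swap at entry `r`: the rung level's pair becomes the old hub pair. [ours] -/
theorem levelSum_swap_both (r : Fin m) (x y : Fin (K + 1) → S) :
    ∑ i : Fin K, G (edgeFlowSwap (Equiv.refl S) 0 (κ r).succ x i.succ) (edgeFlowSwap (Equiv.refl S) 0 (κ r).succ y i.succ)
      = ∑ i : Fin K, G (x i.succ) (y i.succ) - G (x (κ r).succ) (y (κ r).succ) + G (x 0) (y 0) := by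
  rw [levelSum_congr_off (κ r) (fun i hi => homSwap_succ_of_ne κ r x hi) (fun i hi => homSwap_succ_of_ne κ r y hi), homSwap_level, homSwap_level]

/-- Level sum after a swap of the first copy only. [ours] -/
theorem levelSum_swap_left (r : Fin m) (x y : Fin (K + 1) → S) :
    ∑ i : Fin K, G (edgeFlowSwap (Equiv.refl S) 0 (κ r).succ x i.succ) (y i.succ)
      = ∑ i : Fin K, G (x i.succ) (y i.succ) - G (x (κ r).succ) (y (κ r).succ) + G (x 0) (y (κ r).succ) := by
  rw [levelSum_congr_off (κ r) (fun i hi => homSwap_succ_of_ne κ r x hi) (fun i _ => rfl), homSwap_level]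

/-- Level sum after a swap of the second copy only. [ours] -/
theorem levelSum_swap_right (r : Fin m) (x y : Fin (K + 1) → S) :
    ∑ i : Fin K, G (x i.succ) (edgeFlowSwap (Equiv.refl S) 0 (κ r).succ y i.succ)
      = ∑ i : Fin K, G (x i.succ) (y i.succ) - G (x (κ r).succ) (y (κ r).succ) + G (x (κ r).succ) (y 0) := by
  rw [levelSum_congr_off (κ r) (fun i _ => rfl) (fun i hi => homSwap_succ_of_ne κ r y hi), homSwap_level]

/-- A shared redraw does not touch the level sum. [ours] -/
theorem levelSum_redraw (x y : Fin (K + 1) → S) (v : S) :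
    ∑ i : Fin K, G (update x 0 v i.succ) (update y 0 v i.succ) = ∑ i : Fin K, G (x i.succ) (y i.succ) := by
  refine sum_congr rfl fun i _ => ?_
  rw [update_of_ne (Fin.succ_ne_zero i), update_of_ne (Fin.succ_ne_zero i)]

/-- A sum over the list is the multiplicity-weighted sum over the levels. [ours] -/
theorem list_sum_eq_card_sum (f : Fin K → ℝ) :
    ∑ r : Fin m, f (κ r) = ∑ i : Fin K, ((univ.filter fun r : Fin m => κ r = i).card : ℝ) * f i := by
  have h1 : ∀ r : Fin m, f (κ r) = ∑ i : Fin K, (if κ r = i then f i else 0) := fun r => by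
    rw [Finset.sum_ite_eq univ (κ r), if_pos (mem_univ _)]
  simp_rw [h1]
  rw [Finset.sum_comm]
  refine sum_congr rfl fun i _ => ?_
  rw [← Finset.sum_filter, Finset.sum_const, nsmul_eq_mul]

end Book

/-! ## §2 The per-entry brackets -/

section Bracket
variable {K m : ℕ} {S : Type*} [DecidableEq S]
variable (κ : Fin m → Fin K)
variable {acc G E : S → S → ℝ} {net : S → S → S → ℝ} {σ : ℝ}
variable {Ψc : (Fin (K + 1) → S) → (Fin (K + 1) → S) → ℝ} {NETc : S → (Fin (K + 1) → S) → (Fin (K + 1) → S) → ℝ}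
variable {Fc : (Fin (K + 1) → S) → (Fin (K + 1) → S) → ℝ}

/-- After any swap outcome `F(x',y') ≤ Ψ(x',y') + σE(x'_0, y'_0)` (`net ≥ 0`, `E ≥ 0`, `σ ≥ 0`). [ours] -/
theorem addCertL_value_le (hE0 : ∀ u v, 0 ≤ E u v) (hσ0 : 0 ≤ σ) (hN : ∀ z u v, 0 ≤ net z u v)
    (hNETc : ∀ z x y, NETc z x y = ∑ r : Fin m, net z (x (κ r).succ) (y (κ r).succ))
    (hFc : ∀ x y, Fc x y = Ψc x y + (if x 0 = y 0 then -(σ / m) * NETc (x 0) x y else σ * E (x 0) (y 0)))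
    (x y : Fin (K + 1) → S) : Fc x y ≤ Ψc x y + σ * E (x 0) (y 0) := by
  rw [hFc]
  split_ifs with h
  · have h1 : 0 ≤ NETc (x 0) x y := by rw [hNETc]; exact sum_nonneg fun r _ => hN _ _ _
    have h2 : 0 ≤ σ / m := div_nonneg hσ0 (Nat.cast_nonneg m)
    nlinarith [hE0 (x 0) (y 0), mul_nonneg h2 h1]
  · exact le_rfl

/-- **THE PER-ENTRY BRACKET AT AN AGREEING HUB** `z = x_0 = y_0` (level `l = κ_r+1`, contents `u = x_l`, `v = y_l`): the four-term synchronous bracket of entry `r` applied to `F` is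
`≤ Ψ(x,y) − net(z;u,v)`. [ours] -/
theorem addCertL_bracket_agree_le (hacc0 : ∀ u v, 0 ≤ acc u v) (hacc1 : ∀ u v, acc u v ≤ 1)
    (hG0d : ∀ s, G s s = 0) (hE0 : ∀ u v, 0 ≤ E u v) (hσ0 : 0 ≤ σ)
    (hnet : ∀ z u v, net z u v = min (acc z u) (acc z v) * (G u v - σ * E u v)
      - (acc z u - min (acc z u) (acc z v)) * (G z v - G u v + σ * E u z) - (acc z v - min (acc z u) (acc z v)) * (G u z - G u v + σ * E z v))
    (hN : ∀ z u v, 0 ≤ net z u v)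
    (hΨc : ∀ x y, Ψc x y = ∑ i : Fin K, G (x i.succ) (y i.succ))
    (hNETc : ∀ z x y, NETc z x y = ∑ r : Fin m, net z (x (κ r).succ) (y (κ r).succ))
    (hFc : ∀ x y, Fc x y = Ψc x y + (if x 0 = y 0 then -(σ / m) * NETc (x 0) x y else σ * E (x 0) (y 0)))
    (r : Fin m) (x y : Fin (K + 1) → S) (hz : x 0 = y 0) :
    min (acc (x 0) (x (κ r).succ)) (acc (y 0) (y (κ r).succ))
        * Fc (edgeFlowSwap (Equiv.refl S) 0 (κ r).succ x) (edgeFlowSwap (Equiv.refl S) 0 (κ r).succ y)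
      + (acc (x 0) (x (κ r).succ) - min (acc (x 0) (x (κ r).succ)) (acc (y 0) (y (κ r).succ))) * Fc (edgeFlowSwap (Equiv.refl S) 0 (κ r).succ x) y
      + (acc (y 0) (y (κ r).succ) - min (acc (x 0) (x (κ r).succ)) (acc (y 0) (y (κ r).succ))) * Fc x (edgeFlowSwap (Equiv.refl S) 0 (κ r).succ y)
      + (1 - acc (x 0) (x (κ r).succ) - acc (y 0) (y (κ r).succ) + min (acc (x 0) (x (κ r).succ)) (acc (y 0) (y (κ r).succ))) * Fc x y
      ≤ Ψc x y - net (x 0) (x (κ r).succ) (y (κ r).succ) := by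
  have hv := addCertL_value_le κ hE0 hσ0 hN hNETc hFc
  -- the four values
  have h1 := hv (edgeFlowSwap (Equiv.refl S) 0 (κ r).succ x) (edgeFlowSwap (Equiv.refl S) 0 (κ r).succ y)
  have h2 := hv (edgeFlowSwap (Equiv.refl S) 0 (κ r).succ x) y
  have h3 := hv x (edgeFlowSwap (Equiv.refl S) 0 (κ r).succ y)
  rw [hΨc, levelSum_swap_both κ, homSwap_zero, homSwap_zero, ← hΨc, ← hz, hG0d] at h1
  rw [hΨc, levelSum_swap_left κ, homSwap_zero, ← hΨc] at h2
  rw [hΨc, levelSum_swap_right κ, homSwap_zero, ← hΨc, ← hz] at h3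
  have h4 : Fc x y ≤ Ψc x y := by
    rw [hFc, if_pos hz]
    have : 0 ≤ NETc (x 0) x y := by rw [hNETc]; exact sum_nonneg fun r _ => hN _ _ _
    have h2' : 0 ≤ σ / m := div_nonneg hσ0 (Nat.cast_nonneg m)
    nlinarith [mul_nonneg h2' this]
  rw [← hz] at h2 ⊢
  set aX := acc (x 0) (x (κ r).succ)
  set aY := acc (x 0) (y (κ r).succ)
  have c1 : 0 ≤ min aX aY := le_min (hacc0 _ _) (hacc0 _ _)
  have c2 : 0 ≤ aX - min aX aY := sub_nonneg.mpr (min_le_left _ _); have c3 : 0 ≤ aY - min aX aY := sub_nonneg.mpr (min_le_right _ _)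
  have c4 : 0 ≤ 1 - aX - aY + min aX aY := by
    rcases le_total aX aY with h | h <;> [rw [min_eq_left h]; rw [min_eq_right h]] <;> linarith [hacc1 (x 0) (y (κ r).succ), hacc1 (x 0) (x (κ r).succ)]
  rw [hnet]
  nlinarith [mul_le_mul_of_nonneg_left h1 c1, mul_le_mul_of_nonneg_left h2 c2, mul_le_mul_of_nonneg_left h3 c3, mul_le_mul_of_nonneg_left h4 c4]

/-- **THE PER-ENTRY BRACKET AT A DISAGREEING HUB** `(a,b) = (x_0,y_0)`, `a ≠ b` (level contents `s = x_l`, `t = y_l`): `≤ Ψ(x,y) + E(a,b)` by (D). [ours] -/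
theorem addCertL_bracket_disagree_le (hacc0 : ∀ u v, 0 ≤ acc u v) (hacc1 : ∀ u v, acc u v ≤ 1)
    (hE0 : ∀ u v, 0 ≤ E u v) (hσ0 : 0 ≤ σ) (hN : ∀ z u v, 0 ≤ net z u v)
    (hΨc : ∀ x y, Ψc x y = ∑ i : Fin K, G (x i.succ) (y i.succ))
    (hNETc : ∀ z x y, NETc z x y = ∑ r : Fin m, net z (x (κ r).succ) (y (κ r).succ))
    (hFc : ∀ x y, Fc x y = Ψc x y + (if x 0 = y 0 then -(σ / m) * NETc (x 0) x y else σ * E (x 0) (y 0)))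
    (hD : ∀ a b s t, a ≠ b →
      min (acc a s) (acc b t) * (G a b - G s t + σ * E s t) + (acc a s - min (acc a s) (acc b t)) * (G a t - G s t + σ * E s b)
        + (acc b t - min (acc a s) (acc b t)) * (G s b - G s t + σ * E a t) + (1 - acc a s - acc b t + min (acc a s) (acc b t)) * (σ * E a b) ≤ E a b)
    (r : Fin m) (x y : Fin (K + 1) → S) (hab : x 0 ≠ y 0) :
    min (acc (x 0) (x (κ r).succ)) (acc (y 0) (y (κ r).succ))
        * Fc (edgeFlowSwap (Equiv.refl S) 0 (κ r).succ x) (edgeFlowSwap (Equiv.refl S) 0 (κ r).succ y)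
      + (acc (x 0) (x (κ r).succ) - min (acc (x 0) (x (κ r).succ)) (acc (y 0) (y (κ r).succ))) * Fc (edgeFlowSwap (Equiv.refl S) 0 (κ r).succ x) y
      + (acc (y 0) (y (κ r).succ) - min (acc (x 0) (x (κ r).succ)) (acc (y 0) (y (κ r).succ))) * Fc x (edgeFlowSwap (Equiv.refl S) 0 (κ r).succ y)
      + (1 - acc (x 0) (x (κ r).succ) - acc (y 0) (y (κ r).succ) + min (acc (x 0) (x (κ r).succ)) (acc (y 0) (y (κ r).succ))) * Fc x y
      ≤ Ψc x y + E (x 0) (y 0) := by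
  have hv := addCertL_value_le κ hE0 hσ0 hN hNETc hFc
  have h1 := hv (edgeFlowSwap (Equiv.refl S) 0 (κ r).succ x) (edgeFlowSwap (Equiv.refl S) 0 (κ r).succ y)
  have h2 := hv (edgeFlowSwap (Equiv.refl S) 0 (κ r).succ x) y
  have h3 := hv x (edgeFlowSwap (Equiv.refl S) 0 (κ r).succ y)
  rw [hΨc, levelSum_swap_both κ, homSwap_zero, homSwap_zero, ← hΨc] at h1
  rw [hΨc, levelSum_swap_left κ, homSwap_zero, ← hΨc] at h2
  rw [hΨc, levelSum_swap_right κ, homSwap_zero, ← hΨc] at h3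
  have h4 : Fc x y = Ψc x y + σ * E (x 0) (y 0) := by rw [hFc, if_neg hab]
  set α := acc (x 0) (x (κ r).succ)
  set β := acc (y 0) (y (κ r).succ)
  have c1 : 0 ≤ min α β := le_min (hacc0 _ _) (hacc0 _ _)
  have c2 : 0 ≤ α - min α β := sub_nonneg.mpr (min_le_left _ _); have c3 : 0 ≤ β - min α β := sub_nonneg.mpr (min_le_right _ _)
  have c4 : 0 ≤ 1 - α - β + min α β := by
    rcases le_total α β with h | h <;> [rw [min_eq_left h]; rw [min_eq_right h]] <;> linarith [hacc1 (y 0) (y (κ r).succ), hacc1 (x 0) (x (κ r).succ)]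
  have hD' := hD (x 0) (y 0) (x (κ r).succ) (y (κ r).succ) hab
  rw [h4]
  nlinarith [mul_le_mul_of_nonneg_left h1 c1, mul_le_mul_of_nonneg_left h2 c2, mul_le_mul_of_nonneg_left h3 c3]

end Bracket

/-! ## §3 The checklist and the law, any hub list -/

section Law
variable {K m : ℕ} {S : Type*} [Fintype S] [DecidableEq S] {μ : Fin (K + 1) → S → ℝ}
variable (κ : Fin m → Fin K)
variable {M : Fin (K + 1) → S → S → ℝ} {w : Fin (K + 1) → ℝ} {t : ℝ}

/-- **THE ENVIRONMENT-FREE ADDITIVE CERTIFICATE ⇒ MIXING TIME, ANY HUB LIST.**  Homogeneous `q`-content star (persistent hub with exact redraws of weight `w_0 > 0`, `K` idle cold levels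
of one law `μ_1`, identity maps, hub list `(0, κ_r+1)` listing every cold level `≥ c ≥ 1` times, `0 < t < 1`), `G`, `E`, `net`, (N), (D), (R) as in `StarAdditiveCertificate`:
**`t_mix(ε) ≤ ⌈(4/((1−t)w_0·(σκ₀·c/m)))·log((e·(K·G_max) + 1)/ε)⌉₊`**, `σ = t/(t+(1−t)w_0)`. [ours] -/
theorem homStar_mixingTime_le_of_additiveCertificate_list [Nonempty S] (hm : 1 ≤ m) (ht0 : 0 < t) (ht1 : t < 1) (hw0 : ∀ k, 0 ≤ w k) (hw00 : 0 < w 0)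
    (hw1 : ∑ k, w k = 1) (hμ : ∀ k x, 0 < μ k x) (hμ1 : ∀ k, ∑ u, μ k u = 1) (hM0 : ∀ u v, M 0 u v = μ 0 v)
    (hidle : ∀ i : Fin K, ∀ u v, M i.succ u v = if v = u then 1 else 0) (hhom : ∀ i : Fin K, μ i.succ = μ 1)
    {c : ℕ} (hc1 : 1 ≤ c) (hc : ∀ i : Fin K, c ≤ (univ.filter fun r : Fin m => κ r = i).card)
    {acc : S → S → ℝ} (hacc : ∀ u v, acc u v = min 1 (μ 0 v * μ 1 u / (μ 0 u * μ 1 v)))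
    {G E : S → S → ℝ} {Gmax κ₀ σ : ℝ} (hG0d : ∀ s, G s s = 0) (hG1 : ∀ u v, u ≠ v → 1 ≤ G u v) (hG0 : ∀ u v, 0 ≤ G u v) (hGmax : ∀ u v, G u v ≤ Gmax)
    (hE0 : ∀ u v, 0 ≤ E u v) (hσ : σ = t / (t + (1 - t) * w 0))
    {net : S → S → S → ℝ}
    (hnet : ∀ z u v, net z u v = min (acc z u) (acc z v) * (G u v - σ * E u v)
      - (acc z u - min (acc z u) (acc z v)) * (G z v - G u v + σ * E u z) - (acc z v - min (acc z u) (acc z v)) * (G u z - G u v + σ * E z v))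
    (hN : ∀ z u v, 0 ≤ net z u v)
    (hD : ∀ a b s t, a ≠ b →
      min (acc a s) (acc b t) * (G a b - G s t + σ * E s t) + (acc a s - min (acc a s) (acc b t)) * (G a t - G s t + σ * E s b)
        + (acc b t - min (acc a s) (acc b t)) * (G s b - G s t + σ * E a t) + (1 - acc a s - acc b t + min (acc a s) (acc b t)) * (σ * E a b) ≤ E a b)
    (hR : ∀ u v, κ₀ * G u v ≤ ∑ z, μ 0 z * net z u v) (hκ0 : 0 < κ₀) (hκ1 : κ₀ ≤ 1)
    {ε : ℝ} (hε : 0 < ε) :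
    mixingTime (fun y z : Fin (K + 1) → S =>
        t * ptGraphSwap μ (fun r : Fin m => (((0 : Fin (K + 1)), (κ r).succ) : Fin (K + 1) × Fin (K + 1))) (fun _ : Fin m => Equiv.refl S) y z
          + (1 - t) * prodKernel w M y z) (tensorFun μ) ε
      ≤ ⌈1 / ((1 - t) * w 0 * (σ * κ₀ * c / m) / 4) * Real.log ((Real.exp 1 * (K * Gmax) + 1) / ε)⌉₊ := by
  classical
  -- constants
  have hh0 : 0 < (1 - t) * w 0 := mul_pos (by linarith) hw00
  have hth : 0 < t + (1 - t) * w 0 := by linarith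
  have hσ0 : 0 < σ := by rw [hσ]; exact div_pos ht0 hth
  have hσ1 : σ ≤ 1 := by rw [hσ, div_le_one hth]; linarith
  have hσt : σ * (t + (1 - t) * w 0) = t := by rw [hσ]; field_simp
  have hmpos : (0 : ℝ) < m := Nat.cast_pos.mpr (by omega)
  have hcm : ∀ i : Fin K, ((univ.filter fun r : Fin m => κ r = i).card : ℝ) ≤ m := fun i => by
    exact_mod_cast (card_le_univ _).trans_eq (Fintype.card_fin m)
  have hcc : ∀ i : Fin K, (c : ℝ) ≤ ((univ.filter fun r : Fin m => κ r = i).card : ℝ) := fun i => by exact_mod_cast hc i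
  have hcle : (c : ℝ) ≤ m := by
    by_cases hK : K = 0
    · subst hK
      have : m = 0 := by
        rcases Nat.eq_zero_or_pos m with h | h
        · exact h
        · exact (Fin.elim0 (κ ⟨0, h⟩) : False).elim
      omega
    · obtain ⟨i⟩ : Nonempty (Fin K) := Fin.pos_iff_nonempty.mp (Nat.pos_of_ne_zero hK)
      exact (hcc i).trans (hcm i)
  have hacc0 : ∀ u v, 0 ≤ acc u v := fun u v => by
    rw [hacc]; exact le_min zero_le_one (div_nonneg (mul_nonneg (hμ _ _).le (hμ _ _).le) (mul_nonneg (hμ _ _).le (hμ _ _).le))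
  have hacc1 : ∀ u v, acc u v ≤ 1 := fun u v => by rw [hacc]; exact min_le_left _ _
  have hNG : ∀ z u v, net z u v ≤ G u v := net_le_cost hacc0 hacc1 hG0 hE0 hσ0.le hnet
  -- kernels
  have hM : ∀ k, IsRowStochastic (M k) := fun k => by
    cases k using Fin.cases with
    | zero => exact ⟨fun u v => by rw [hM0]; exact (hμ 0 v).le, fun u => by simp_rw [hM0]; exact hμ1 0⟩
    | succ i =>
      refine ⟨fun u v => by rw [hidle]; split_ifs <;> norm_num, fun u => ?_⟩
      simp_rw [hidle i]
      rw [Finset.sum_ite_eq' univ u, if_pos (mem_univ _)]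
  have hMrev : ∀ k, DetailedBalance (μ k) (M k) := fun k => by
    intro u v
    cases k using Fin.cases with
    | zero => rw [hM0, hM0, mul_comm]
    | succ i =>
      rw [hidle, hidle]
      by_cases huv : u = v
      · subst huv; rfl
      · rw [if_neg (Ne.symm huv), if_neg huv, mul_zero, mul_zero]
  -- the coupling data and the certificate pair
  let α : Fin m → (Fin (K + 1) → S) → ℝ := fun r z => min 1 (tensorFun μ (edgeFlowSwap (Equiv.refl S) 0 (κ r).succ z) / tensorFun μ z)
  have hα : ∀ r z, α r z = min 1 (tensorFun μ (edgeFlowSwap ((fun _ : Fin m => Equiv.refl S) r) 0 (κ r).succ z) / tensorFun μ z) := fun r z => rfl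
  have hαacc : ∀ r z, α r z = acc (z 0) (z (κ r).succ) := fun r z => homStar_accept_eq_acc κ hμ hhom hα hacc r z
  let R : (Fin (K + 1) → S) × (Fin (K + 1) → S) → (Fin (K + 1) → S) × (Fin (K + 1) → S) → ℝ := fun a b =>
      ∑ v : S, μ 0 v * (if b.1 = update a.1 0 v ∧ b.2 = update a.2 0 v then (1 : ℝ) else 0)
  have hRk : ∀ a b, R a b = ∑ v : S, μ 0 v * (if b.1 = update a.1 0 v ∧ b.2 = update a.2 0 v then (1 : ℝ) else 0) := fun a b => rfl
  let Ψc : (Fin (K + 1) → S) → (Fin (K + 1) → S) → ℝ := fun x y => ∑ i : Fin K, G (x i.succ) (y i.succ)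
  have hΨc : ∀ x y, Ψc x y = ∑ i : Fin K, G (x i.succ) (y i.succ) := fun x y => rfl
  let NETc : S → (Fin (K + 1) → S) → (Fin (K + 1) → S) → ℝ := fun z x y => ∑ r : Fin m, net z (x (κ r).succ) (y (κ r).succ)
  have hNETc : ∀ z x y, NETc z x y = ∑ r : Fin m, net z (x (κ r).succ) (y (κ r).succ) := fun z x y => rfl
  let Fc : (Fin (K + 1) → S) → (Fin (K + 1) → S) → ℝ := fun x y =>
      Ψc x y + (if x 0 = y 0 then -(σ / m) * NETc (x 0) x y else σ * E (x 0) (y 0))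
  have hFc : ∀ x y, Fc x y = Ψc x y + (if x 0 = y 0 then -(σ / m) * NETc (x 0) x y else σ * E (x 0) (y 0)) := fun x y => rfl
  have hΨnn : ∀ x y : Fin (K + 1) → S, 0 ≤ Ψc x y := fun x y => sum_nonneg fun i _ => hG0 _ _
  have hNETnn : ∀ z (x y : Fin (K + 1) → S), 0 ≤ NETc z x y := fun z x y => sum_nonneg fun r _ => hN _ _ _
  -- `Σ_r G(x_{l_r}, y_{l_r})` against `Ψ`: between `c·Ψ` and `m·Ψ`
  have hlistG : ∀ x y : Fin (K + 1) → S, (c : ℝ) * Ψc x y ≤ ∑ r : Fin m, G (x (κ r).succ) (y (κ r).succ)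
      ∧ ∑ r : Fin m, G (x (κ r).succ) (y (κ r).succ) ≤ m * Ψc x y := by
    intro x y
    rw [list_sum_eq_card_sum κ (fun i => G (x i.succ) (y i.succ)), hΨc, Finset.mul_sum, Finset.mul_sum]
    exact ⟨sum_le_sum fun i _ => mul_le_mul_of_nonneg_right (hcc i) (hG0 _ _),
      sum_le_sum fun i _ => mul_le_mul_of_nonneg_right (hcm i) (hG0 _ _)⟩
  refine starCycle_mixingTime_le_of_idle_supersolution κ (fun _ : Fin m => Equiv.refl S) hm ht0.le ht1 hw0 hw00 hw1 hμ hμ1 hM hMrev hM0 hidle hα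
    (Q := fun a b => ∑ r : Fin m, t / m *
        (min (α r a.1) (α r a.2) * (if b.1 = edgeFlowSwap (Equiv.refl S) 0 (κ r).succ a.1
              ∧ b.2 = edgeFlowSwap (Equiv.refl S) 0 (κ r).succ a.2 then (1 : ℝ) else 0)
          + (α r a.1 - min (α r a.1) (α r a.2)) * (if b.1 = edgeFlowSwap (Equiv.refl S) 0 (κ r).succ a.1 ∧ b.2 = a.2
              then (1 : ℝ) else 0)
          + (α r a.2 - min (α r a.1) (α r a.2)) * (if b.1 = a.1 ∧ b.2 = edgeFlowSwap (Equiv.refl S) 0 (κ r).succ a.2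
              then (1 : ℝ) else 0)
          + (1 - α r a.1 - α r a.2 + min (α r a.1) (α r a.2)) * (if b.1 = a.1 ∧ b.2 = a.2 then (1 : ℝ) else 0))
      + (1 - t) * ∑ k : Fin (K + 1), w k *
        (if a.1 k = a.2 k ∨ k = 0 then
            ∑ v : S, M k (a.1 k) v * (if b.1 = update a.1 k v ∧ b.2 = update a.2 k v then (1 : ℝ) else 0)
          else coordKernel M k a.1 b.1 * coordKernel M k a.2 b.2))
    (fun a b => rfl) (R := R) hRk (M' := fun a b => _ ) (fun a b => rfl) (ind := fun a => if a.1 = a.2 then 0 else 1) (fun a => rfl)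
    (Ψ := fun a => Ψc a.1 a.2) (Ψmax := K * Gmax) (ρ := σ * κ₀ * c / m) (fun a => hΨnn a.1 a.2) (fun a => ?_) (fun a hex => ?_) (by positivity) ?_
    (F := fun a => Fc a.1 a.2) (fun a => ?_) (fun a => ?_) (fun a => ?_) hε
  · -- `Ψ ≤ K·G_max`
    show Ψc a.1 a.2 ≤ K * Gmax
    calc Ψc a.1 a.2 = ∑ i : Fin K, G (a.1 i.succ) (a.2 i.succ) := rfl
      _ ≤ ∑ _i : Fin K, Gmax := sum_le_sum fun i _ => hGmax _ _
      _ = K * Gmax := by rw [sum_const, card_univ, Fintype.card_fin, nsmul_eq_mul]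
  · -- `Ψ ≥ 1` where a cold level differs
    obtain ⟨i, hi⟩ := hex
    show 1 ≤ Ψc a.1 a.2
    calc (1 : ℝ) ≤ G (a.1 i.succ) (a.2 i.succ) := hG1 _ _ hi
      _ ≤ Ψc a.1 a.2 := Finset.single_le_sum (f := fun i : Fin K => G (a.1 i.succ) (a.2 i.succ)) (fun j _ => hG0 _ _) (mem_univ i)
  · -- `ρ ≤ 1`
    rw [div_le_one hmpos]
    calc σ * κ₀ * c ≤ 1 * 1 * c := by gcongr
      _ = c := by ring
      _ ≤ m := hcle
  · -- `F ≥ 0`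
    show 0 ≤ Fc a.1 a.2
    rw [hFc]
    split_ifs with h
    · have h1 : NETc (a.1 0) a.1 a.2 ≤ m * Ψc a.1 a.2 := by
        rw [hNETc]
        exact (sum_le_sum fun r _ => hNG _ _ _).trans (hlistG a.1 a.2).2
      have h2 : σ / m * NETc (a.1 0) a.1 a.2 ≤ σ * Ψc a.1 a.2 := by
        rw [div_mul_eq_mul_div, div_le_iff₀ hmpos]
        nlinarith [mul_le_mul_of_nonneg_left h1 hσ0.le]
      nlinarith [hΨnn a.1 a.2, mul_le_mul_of_nonneg_right hσ1 (hΨnn a.1 a.2)]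
    · nlinarith [hΨnn a.1 a.2, hE0 (a.1 0) (a.2 0), hσ0]
  · -- the bracket inequality, entry by entry
    show (1 - t) * w 0 * Ψc a.1 a.2 + ∑ r : Fin m, t / m *
        (min (α r a.1) (α r a.2) * Fc (edgeFlowSwap (Equiv.refl S) 0 (κ r).succ a.1) (edgeFlowSwap (Equiv.refl S) 0 (κ r).succ a.2)
          + (α r a.1 - min (α r a.1) (α r a.2)) * Fc (edgeFlowSwap (Equiv.refl S) 0 (κ r).succ a.1) a.2
          + (α r a.2 - min (α r a.1) (α r a.2)) * Fc a.1 (edgeFlowSwap (Equiv.refl S) 0 (κ r).succ a.2)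
          + (1 - α r a.1 - α r a.2 + min (α r a.1) (α r a.2)) * Fc a.1 a.2)
      ≤ (t + (1 - t) * w 0) * Fc a.1 a.2
    simp_rw [hαacc]
    have htm : 0 ≤ t / m := div_nonneg ht0.le hmpos.le
    by_cases hab : a.1 0 = a.2 0
    · have hterm : ∀ r : Fin m, t / m *
          (min (acc (a.1 0) (a.1 (κ r).succ)) (acc (a.2 0) (a.2 (κ r).succ))
              * Fc (edgeFlowSwap (Equiv.refl S) 0 (κ r).succ a.1) (edgeFlowSwap (Equiv.refl S) 0 (κ r).succ a.2)
            + (acc (a.1 0) (a.1 (κ r).succ) - min (acc (a.1 0) (a.1 (κ r).succ)) (acc (a.2 0) (a.2 (κ r).succ)))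
              * Fc (edgeFlowSwap (Equiv.refl S) 0 (κ r).succ a.1) a.2
            + (acc (a.2 0) (a.2 (κ r).succ) - min (acc (a.1 0) (a.1 (κ r).succ)) (acc (a.2 0) (a.2 (κ r).succ)))
              * Fc a.1 (edgeFlowSwap (Equiv.refl S) 0 (κ r).succ a.2)
            + (1 - acc (a.1 0) (a.1 (κ r).succ) - acc (a.2 0) (a.2 (κ r).succ)
                + min (acc (a.1 0) (a.1 (κ r).succ)) (acc (a.2 0) (a.2 (κ r).succ))) * Fc a.1 a.2)
          ≤ t / m * (Ψc a.1 a.2 - net (a.1 0) (a.1 (κ r).succ) (a.2 (κ r).succ)) := fun r =>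
        mul_le_mul_of_nonneg_left (addCertL_bracket_agree_le κ hacc0 hacc1 hG0d hE0 hσ0.le hnet hN hΨc hNETc hFc r a.1 a.2 hab) htm
      have hsum := sum_le_sum fun r (_ : r ∈ (univ : Finset (Fin m))) => hterm r
      have hsplit : ∑ r : Fin m, t / m * (Ψc a.1 a.2 - net (a.1 0) (a.1 (κ r).succ) (a.2 (κ r).succ))
          = t * Ψc a.1 a.2 - t / m * NETc (a.1 0) a.1 a.2 := by
        have e1 : ∑ r : Fin m, t / m * (Ψc a.1 a.2 - net (a.1 0) (a.1 (κ r).succ) (a.2 (κ r).succ))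
            = ∑ r : Fin m, (t / m * Ψc a.1 a.2 - t / m * net (a.1 0) (a.1 (κ r).succ) (a.2 (κ r).succ)) := sum_congr rfl fun r _ => by ring
        have e2 : ∑ r : Fin m, t / m * Ψc a.1 a.2 = t * Ψc a.1 a.2 := by
          rw [sum_const, card_univ, Fintype.card_fin, nsmul_eq_mul]; field_simp
        have e3 : ∑ r : Fin m, t / m * net (a.1 0) (a.1 (κ r).succ) (a.2 (κ r).succ) = t / m * NETc (a.1 0) a.1 a.2 := by
          rw [hNETc, Finset.mul_sum]
        rw [e1, Finset.sum_sub_distrib, e2, e3]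
      rw [hsplit] at hsum
      have hF : (t + (1 - t) * w 0) * Fc a.1 a.2 = (t + (1 - t) * w 0) * Ψc a.1 a.2 - t / m * NETc (a.1 0) a.1 a.2 := by
        rw [hFc, if_pos hab, mul_add, show (t + (1 - t) * w 0) * (-(σ / m) * NETc (a.1 0) a.1 a.2)
          = -(σ * (t + (1 - t) * w 0) / m * NETc (a.1 0) a.1 a.2) by ring, hσt]
        ring
      rw [hF]
      linarith [hsum]
    · have hterm : ∀ r : Fin m, t / m *
          (min (acc (a.1 0) (a.1 (κ r).succ)) (acc (a.2 0) (a.2 (κ r).succ))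
              * Fc (edgeFlowSwap (Equiv.refl S) 0 (κ r).succ a.1) (edgeFlowSwap (Equiv.refl S) 0 (κ r).succ a.2)
            + (acc (a.1 0) (a.1 (κ r).succ) - min (acc (a.1 0) (a.1 (κ r).succ)) (acc (a.2 0) (a.2 (κ r).succ)))
              * Fc (edgeFlowSwap (Equiv.refl S) 0 (κ r).succ a.1) a.2
            + (acc (a.2 0) (a.2 (κ r).succ) - min (acc (a.1 0) (a.1 (κ r).succ)) (acc (a.2 0) (a.2 (κ r).succ)))
              * Fc a.1 (edgeFlowSwap (Equiv.refl S) 0 (κ r).succ a.2)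
            + (1 - acc (a.1 0) (a.1 (κ r).succ) - acc (a.2 0) (a.2 (κ r).succ)
                + min (acc (a.1 0) (a.1 (κ r).succ)) (acc (a.2 0) (a.2 (κ r).succ))) * Fc a.1 a.2)
          ≤ t / m * (Ψc a.1 a.2 + E (a.1 0) (a.2 0)) := fun r =>
        mul_le_mul_of_nonneg_left (addCertL_bracket_disagree_le κ hacc0 hacc1 hE0 hσ0.le hN hΨc hNETc hFc hD r a.1 a.2 hab) htm
      have hsum := sum_le_sum fun r (_ : r ∈ (univ : Finset (Fin m))) => hterm r
      have hconst : ∑ r : Fin m, t / m * (Ψc a.1 a.2 + E (a.1 0) (a.2 0)) = t * Ψc a.1 a.2 + t * E (a.1 0) (a.2 0) := by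
        rw [sum_const, card_univ, Fintype.card_fin, nsmul_eq_mul]; field_simp
      rw [hconst] at hsum
      have hF : (t + (1 - t) * w 0) * Fc a.1 a.2 = (t + (1 - t) * w 0) * Ψc a.1 a.2 + t * E (a.1 0) (a.2 0) := by
        rw [hFc, if_neg hab, mul_add, show (t + (1 - t) * w 0) * (σ * E (a.1 0) (a.2 0)) = σ * (t + (1 - t) * w 0) * E (a.1 0) (a.2 0) by ring, hσt]
      rw [hF]
      linarith [hsum]
  · -- the redraw inequality
    show (Matrix.mulVec (fun a b => R a b) (fun a => Fc a.1 a.2)) a ≤ (1 - σ * κ₀ * c / m) * Ψc a.1 a.2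
    rw [starSync_redraw_mulVec_apply hRk (fun a => Fc a.1 a.2) a]
    dsimp only
    have hFv : ∀ v, Fc (update a.1 0 v) (update a.2 0 v) = Ψc a.1 a.2 - σ / m * NETc v a.1 a.2 := fun v => by
      rw [hFc, if_pos (by rw [update_self, update_self]), hΨc, levelSum_redraw, ← hΨc, update_self, hNETc, hNETc]
      have : ∑ r : Fin m, net v (update a.1 0 v (κ r).succ) (update a.2 0 v (κ r).succ) = ∑ r : Fin m, net v (a.1 (κ r).succ) (a.2 (κ r).succ) :=
        sum_congr rfl fun r _ => by rw [update_of_ne (Fin.succ_ne_zero _), update_of_ne (Fin.succ_ne_zero _)]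
      rw [this]; ring
    simp_rw [hFv, mul_sub]
    rw [Finset.sum_sub_distrib, ← Finset.sum_mul, hμ1 0, one_mul]
    have hex : ∑ v, μ 0 v * (σ / m * NETc v a.1 a.2) = σ / m * ∑ r : Fin m, ∑ v, μ 0 v * net v (a.1 (κ r).succ) (a.2 (κ r).succ) := by
      simp_rw [hNETc, Finset.mul_sum]
      rw [Finset.sum_comm]
      exact sum_congr rfl fun r _ => sum_congr rfl fun v _ => by ring
    rw [hex]
    have hlow : κ₀ * (c * Ψc a.1 a.2) ≤ ∑ r : Fin m, ∑ v, μ 0 v * net v (a.1 (κ r).succ) (a.2 (κ r).succ) := by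
      calc κ₀ * (c * Ψc a.1 a.2) ≤ κ₀ * ∑ r : Fin m, G (a.1 (κ r).succ) (a.2 (κ r).succ) := mul_le_mul_of_nonneg_left (hlistG a.1 a.2).1 hκ0.le
        _ = ∑ r : Fin m, κ₀ * G (a.1 (κ r).succ) (a.2 (κ r).succ) := by rw [Finset.mul_sum]
        _ ≤ _ := sum_le_sum fun r _ => hR _ _
    have h3 : 0 ≤ σ / m := div_nonneg hσ0.le hmpos.le
    have : σ * κ₀ * c / m * Ψc a.1 a.2 = σ / m * (κ₀ * (c * Ψc a.1 a.2)) := by ring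
    nlinarith [mul_le_mul_of_nonneg_left hlow h3, this]

end Law

end Summit.Ventures.LatticeQCDFlow.Scaling

end
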